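import Literature.NumberTheory.Transcendental.QuadraticRelationsLogarithmsThm01
import Literature.NumberTheory.Transcendental.RationalSubspaces
import Mathlib.LinearAlgebra.FreeModule.PID
import Mathlib.LinearAlgebra.Dimension.Localization
import Mathlib.LinearAlgebra.LinearIndependent.BaseChange
import HarnessLib

/-!
# Roy–Waldschmidt 1997: Théorème 0.1 from Corollaire 1.4 (the printed deduction of p. 760, PROVED)

Continuation of `QuadraticRelationsLogarithmsThm01.lean` (Théorème 0.2 ⇐ Théorème 0.1) one step
up the printed chain Théorème 0.2 ⇐ Théorème 0.1 ⇐ Corollaire 1.4 ⇐ Corollaire 1.3 ⇐ Théorème 1.1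
of D. Roy, M. Waldschmidt, *Approximation diophantienne et indépendance algébrique de logarithmes*,
Ann. Sci. ÉNS (4) 30 (1997) 753–796.

* `RoyWaldschmidt1997.thm_0_1_of_cor_1_4` — **Théorème 0.1 follows from Corollaire 1.4**, the
  latter as an explicit hypothesis rendered verbatim (p. 759): "Soient `d` un entier positif, `K`
  un sous-corps de `ℂ` de degré de transcendance `1` sur `ℚ`, et `X` un sous-groupe de type fini
  de `(𝓛_K ∩ K)^d`. On pose `n = dim_ℂ(ℂX)`. Alors, il existe un sous-espace `U` de `ℂ^d` défini
  sur `ℚ` tel que `rang_ℤ(X/(X ∩ U)) + dim_ℂ(U) ≤ 2n` avec l'inégalité stricte si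
  `X ∩ 𝓛^d ≠ 0`."  (`X` a finitely generated `ℤ`-submodule of `ℂ^d`; `rang_ℤ(X/(X ∩ U))` the
  `finrank` over `ℤ` of the quotient of `X` by `X ∩ U`; "défini sur `ℚ`" = `ratSpan`.)
* `royWaldschmidt_quadratic_thm_0_2_of_cor_1_4` — hence Théorème 0.2 from Corollaire 1.4.

Proof of Théorème 0.1 as printed (p. 760): `X` = the subgroup generated by the columns of `M`
(so `dim ℂX = rank M`), `U` from Corollaire 1.4, `Λ = {x ∈ ℤᵗ ; Mx ∈ U}`, `S = ℂΛ`,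
`T = {N ; NS ⊆ U}`; then `M ∈ T`, `T` is defined over `ℚ` (`Λ` is generated by finitely many
integer vectors `λₖ`, `T = ⋂ₖ evₖ⁻¹(U)` for the rational maps `N ↦ Nλₖ`, and preimages and finite
intersections of subspaces defined over `ℚ` are defined over `ℚ`:
`LiePresentation.IsKRational.comap_of_ofK`, `LiePresentation.isKRational_iInf`), and
`rank N ≤ dim(ℂᵗ/S) + dim U = rang_ℤ(X/(X ∩ U)) + dim U` for `N ∈ T` (`dim S = rang_ℤ Λ` because
`ℤ`-independent integer vectors are `ℂ`-independent, Mathlib's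
`linearIndependent_algebraMap_comp_iff`, and `ℤᵗ/Λ ≅ X/(X ∩ U)`).

No definitions, no named facts (D-0026): the statements of Théorème 0.1 and Corollaire 1.4 are
hypotheses/conclusions written out in full.

## References

* [RoyWaldschmidt1997ENS] D. Roy, M. Waldschmidt, Ann. Sci. ÉNS (4) 30 (1997) 753–796:
  Théorème 0.1 p. 755, Corollaire 1.4 p. 759, "Démonstration du théorème 0.1" p. 760
  (lit key paper:doi-10-1016-s0012-9593-97-89938-7, PDF pp. 4, 8–9).
-/

noncomputable section

open Complex IntermediateField Module Submodule
open scoped Matrix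

namespace Literature.NumberTheory.Transcendental

/-! ### More on `K`-rational subspaces (complements to `RationalSubspaces.lean`) -/

namespace LiePresentation

variable (K : Type*) {L : Type*} [Field K] [Field L] [Algebra K L] {σ τ : Type*}

/-- The whole space is `K`-rational (a private copy of
`LiePresentation.isKRational_top` of `IndexDescent.lean`, whose heavy imports are not wanted
here). [folklore] -/
private theorem isKRational_top' [Fintype σ] [DecidableEq σ] :
    IsKRational K (⊤ : Submodule L (σ → L)) := by
  refine ⟨Set.univ, le_antisymm (fun w _ => ?_) le_top⟩
  rw [pi_eq_sum_univ w]
  refine Submodule.sum_mem _ fun i _ => Submodule.smul_mem _ _ (subset_span ⟨Pi.single i 1, trivial, ?_⟩)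
  funext j
  by_cases h : i = j
  · subst h; simp
  · simp [Ne.symm h, h]

variable {K}

/-- **Finite intersections of `K`-rational subspaces are `K`-rational.** [folklore] -/
theorem isKRational_iInf [Fintype σ] [DecidableEq σ] {ι : Type*} [Finite ι]
    {W : ι → Submodule L (σ → L)} (h : ∀ i, IsKRational K (W i)) : IsKRational K (⨅ i, W i) := by
  classical
  haveI := Fintype.ofFinite ι
  suffices key : ∀ s : Finset ι, IsKRational K (⨅ i ∈ s, W i) by
    have e : (⨅ i, W i) = ⨅ i ∈ (Finset.univ : Finset ι), W i := by simp
    rw [e]; exact key _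
  intro s
  induction s using Finset.induction_on with
  | empty => simpa using isKRational_top' K
  | insert a s ha ih => rw [Finset.iInf_insert]; exact (h a).inf K ih

/-- **Preimages of `K`-rational subspaces under `K`-rational linear maps are `K`-rational.**
If `f : L^σ → L^τ` restricts to a `K`-linear `f₀ : K^σ → K^τ` (`f ∘ ofK = ofK ∘ f₀`) and `W ≤ L^τ`
is `K`-rational then `f⁻¹(W)` is `K`-rational: in a `K`-basis of `L`, the `j`-th coefficient
vector of `f w` is `f₀` of the `j`-th coefficient vector of `w`, and coefficient vectors of
elements of `W` are `K`-points of `W`. [folklore] -/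
theorem IsKRational.comap_of_ofK [Fintype σ] [DecidableEq σ] [Fintype τ]
    (f : (σ → L) →ₗ[L] (τ → L)) (f₀ : (σ → K) →ₗ[K] (τ → K))
    (hf : ∀ v : σ → K, f (ofK K v) = ofK K (f₀ v)) {W : Submodule L (τ → L)} (hW : IsKRational K W) :
    IsKRational K (W.comap f) := by
  classical
  refine ⟨(kPoints K (W.comap f) : Set (σ → K)), le_antisymm ?_ (span_kPoints_le K _)⟩
  intro w hw
  let c := Basis.ofVectorSpace K L
  obtain ⟨S₀, hS₀⟩ := eq_sum_smul_ofK_coeff K c w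
  -- the `j`-th coefficient vector of `f w` is `f₀` of that of `w`
  have hcoef : ∀ j, (fun k => c.repr (f w k) j) = f₀ (fun i => c.repr (w i) j) := by
    intro j
    -- matrix form of `f`: `f w = ∑ᵢ wᵢ • ofK (f₀ eᵢ)`
    have hfw : f w = ∑ i, w i • ofK K (L := L) (f₀ (Pi.single i 1)) := by
      conv_lhs => rw [show w = ∑ i, w i • ofK K (L := L) (Pi.single i (1 : K)) from by
        funext k
        simp only [Finset.sum_apply, Pi.smul_apply, ofK_apply, smul_eq_mul]
        rw [Finset.sum_eq_single k]
        · simp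
        · intro i _ hik; simp [Ne.symm hik]
        · simp]
      rw [map_sum]
      exact Finset.sum_congr rfl fun i _ => by rw [map_smul, hf]
    have hv : (fun i => c.repr (w i) j) = ∑ i, (c.repr (w i) j) • (Pi.single i (1 : K)) := by
      funext k
      simp only [Finset.sum_apply, Pi.smul_apply, smul_eq_mul]
      rw [Finset.sum_eq_single k]
      · simp
      · intro i _ hik; simp [Ne.symm hik]
      · simp
    rw [hv, map_sum]
    funext k
    rw [hfw]
    simp only [Finset.sum_apply, Pi.smul_apply, ofK_apply, smul_eq_mul, map_sum, map_smul,
      Finsupp.coe_finsetSum]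
    refine Finset.sum_congr rfl fun i _ => ?_
    rw [show w i * algebraMap K L (f₀ (Pi.single i 1) k) = (f₀ (Pi.single i 1) k) • w i by
      rw [Algebra.smul_def, mul_comm], map_smul, Finsupp.smul_apply, smul_eq_mul, mul_comm]
  -- hence each coefficient vector of `w` is a `K`-point of `f⁻¹(W)`
  have hmem : ∀ j, (fun i => c.repr (w i) j) ∈ kPoints K (W.comap f) := by
    intro j
    rw [mem_kPoints, Submodule.mem_comap, hf, ← hcoef j]
    exact hW.coeff_mem_kPoints K c hw j
  rw [hS₀]
  exact Submodule.sum_mem _ fun j _ => Submodule.smul_mem _ _ (subset_span ⟨_, hmem j, rfl⟩)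

end LiePresentation

namespace RoyWaldschmidt1997

open LiePresentation

variable {d t : ℕ}

/-! ### Integer lattices in `ℂᵗ` -/

/-- The complexification `ℤᵗ → ℂᵗ`. [folklore] -/
theorem intCast_eq_ofK (z : Fin t → ℤ) :
    (fun j => ((z j : ℤ) : ℂ)) = ofK ℚ (L := ℂ) (fun j => (z j : ℚ)) := by
  funext j; simp

/-- **`ℤ`-independent integer vectors are `ℂ`-independent; the `ℂ`-span of a subgroup `Λ ≤ ℤᵗ`
has dimension `rang_ℤ Λ`.**  With `b` a `ℤ`-basis of `Λ`: the complexified `b k` form a basis of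
`ℂΛ`. [folklore] -/
theorem finrank_span_intCast (Λ : Submodule ℤ (Fin t → ℤ)) {r : ℕ} (b : Basis (Fin r) ℤ Λ) :
    LinearIndependent ℂ (fun k => fun j => (((b k : Fin t → ℤ) j : ℤ) : ℂ)) ∧
    Module.finrank ℂ (span ℂ (Set.range fun k => fun j => (((b k : Fin t → ℤ) j : ℤ) : ℂ))) = r := by
  have hb : LinearIndependent ℤ (fun k => (b k : Fin t → ℤ)) :=
    b.linearIndependent.map' Λ.subtype (Submodule.ker_subtype Λ)
  have hli : LinearIndependent ℂ (fun k => fun j => (((b k : Fin t → ℤ) j : ℤ) : ℂ)) := by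
    have := (linearIndependent_algebraMap_comp_iff (R := ℤ) (S := ℂ)).mpr hb
    simpa [Function.comp_def] using this
  exact ⟨hli, by rw [finrank_span_eq_card hli, Fintype.card_fin]⟩

/-! ### Théorème 0.1 from Corollaire 1.4 -/

/-- **Roy–Waldschmidt 1997: Théorème 0.1 follows from Corollaire 1.4 (the printed deduction,
p. 760, PROVED).**  Hypothesis `h14` is Corollaire 1.4 verbatim (p. 759): for a subfield `K ⊆ ℂ`
of transcendence degree `1` over `ℚ` and a finitely generated subgroup `X` of `(𝓛_K ∩ K)^d` with
`n = dim_ℂ(ℂX)`, there is a subspace `U ⊆ ℂ^d` defined over `ℚ` with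
`rang_ℤ(X/(X ∩ U)) + dim_ℂ U ≤ 2n`, and `< 2n` if `X ∩ 𝓛^d ≠ 0` (`𝓛 = exp⁻¹(ℚ̄^×)`).
Conclusion: Théorème 0.1 in the exact form of the hypothesis `h01` of
`royWaldschmidt_quadratic_thm_0_2_of_thm_0_1`.  Proof as printed: `X` = the group generated by
the columns of `M`, `Λ = {x ∈ ℤᵗ ; Mx ∈ U}`, `S = ℂΛ`, `T = {N ; NS ⊆ U} ∋ M`, defined over `ℚ`,
with `rank N ≤ dim(ℂᵗ/S) + dim U = rang_ℤ(X/(X ∩ U)) + dim U`.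
[cite: RoyWaldschmidt1997ENS, Corollaire 1.4 p. 759 and "Démonstration du théorème 0.1" p. 760] -/
theorem thm_0_1_of_cor_1_4
    (h14 : ∀ (K : IntermediateField ℚ ℂ), Algebra.trdeg ℚ K = 1 →
      ∀ (d : ℕ) (X : Submodule ℤ (Fin d → ℂ)), X.FG →
        (∀ x ∈ X, ∀ i, x i ∈ K ∧ cexp (x i) ∈ K) →
        ∃ U : Submodule ℂ (Fin d → ℂ), (∃ s : Set (Fin d → ℚ), U = ratSpan s) ∧
          Module.finrank ℤ (↥X ⧸ (U.restrictScalars ℤ).comap X.subtype) + Module.finrank ℂ U ≤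
            2 * Module.finrank ℂ (span ℂ (X : Set (Fin d → ℂ))) ∧
          ((∃ x ∈ X, x ≠ 0 ∧ ∀ i, IsAlgebraic ℚ (cexp (x i))) →
            Module.finrank ℤ (↥X ⧸ (U.restrictScalars ℤ).comap X.subtype) + Module.finrank ℂ U <
              2 * Module.finrank ℂ (span ℂ (X : Set (Fin d → ℂ)))))
    (K : IntermediateField ℚ ℂ) (hK : Algebra.trdeg ℚ K = 1) (d t : ℕ)
    (M : Matrix (Fin d) (Fin t) ℂ) (hM : ∀ i j, M i j ∈ K ∧ cexp (M i j) ∈ K) :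
    (∃ T : Submodule ℂ (Matrix (Fin d) (Fin t) ℂ),
      (∃ S : Set (Matrix (Fin d) (Fin t) ℚ),
        T = span ℂ ((fun A : Matrix (Fin d) (Fin t) ℚ => A.map (algebraMap ℚ ℂ)) '' S)) ∧
      M ∈ T ∧ ∀ N ∈ T, N.rank ≤ 2 * M.rank) ∧
    ((∃ j, (∀ i, IsAlgebraic ℚ (cexp (M i j))) ∧ ∃ i, M i j ≠ 0) →
      ∃ T : Submodule ℂ (Matrix (Fin d) (Fin t) ℂ),
        (∃ S : Set (Matrix (Fin d) (Fin t) ℚ),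
          T = span ℂ ((fun A : Matrix (Fin d) (Fin t) ℚ => A.map (algebraMap ℚ ℂ)) '' S)) ∧
        M ∈ T ∧ ∀ N ∈ T, N.rank < 2 * M.rank) := by
  classical
  -- `X` = the subgroup of `ℂ^d` generated by the columns of `M`, as the image of `ℤᵗ`
  let φ : (Fin t → ℤ) →ₗ[ℤ] (Fin d → ℂ) :=
    { toFun := fun z => M *ᵥ fun j => ((z j : ℤ) : ℂ)
      map_add' := fun z z' => by
        rw [← Matrix.mulVec_add]; congr 1; funext j; simp
      map_smul' := fun m z => by
        rw [RingHom.id_apply, ← Matrix.mulVec_smul]; congr 1; funext j; simp }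
  have hφ : ∀ z, φ z = M *ᵥ fun j => ((z j : ℤ) : ℂ) := fun z => rfl
  let X : Submodule ℤ (Fin d → ℂ) := LinearMap.range φ
  have hXfg : X.FG := by
    rw [show X = (⊤ : Submodule ℤ (Fin t → ℤ)).map φ from (Submodule.map_top φ).symm]
    exact Submodule.FG.map _ Module.Finite.fg_top
  have hXK : ∀ x ∈ X, ∀ i, x i ∈ K ∧ cexp (x i) ∈ K := by
    rintro _ ⟨z, rfl⟩ i
    rw [hφ, Matrix.mulVec, dotProduct]
    refine ⟨sum_mem fun j _ => mul_mem (hM i j).1 (intCast_mem K (z j)), ?_⟩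
    rw [Complex.exp_sum]
    refine prod_mem fun j _ => ?_
    rw [mul_comm, Complex.exp_int_mul]
    exact zpow_mem (hM i j).2 _
  -- `dim ℂX = rank M`
  have hspanX : span ℂ (X : Set (Fin d → ℂ)) = LinearMap.range M.mulVecLin := by
    refine le_antisymm (span_le.mpr ?_) ?_
    · rintro _ ⟨z, rfl⟩
      exact ⟨_, rfl⟩
    · rw [Matrix.range_mulVecLin]
      refine span_mono ?_
      rintro _ ⟨j, rfl⟩
      refine ⟨Pi.single j 1, ?_⟩
      rw [hφ]
      have e : (fun k => (((Pi.single j (1 : ℤ) : Fin t → ℤ) k : ℤ) : ℂ)) = Pi.single j (1 : ℂ) := by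
        funext k; by_cases h : k = j
        · subst h; simp
        · simp [h]
      rw [e, Matrix.mulVec_single, MulOpposite.op_one, one_smul]
  have hn : Module.finrank ℂ (span ℂ (X : Set (Fin d → ℂ))) = M.rank := by
    rw [hspanX]; rfl
  -- Corollaire 1.4
  obtain ⟨U, ⟨s, hUs⟩, hle, hlt⟩ := h14 K hK d X hXfg hXK
  -- `Λ = {x ∈ ℤᵗ ; Mx ∈ U}` and a `ℤ`-basis `b` of it
  let Λ : Submodule ℤ (Fin t → ℤ) := (U.restrictScalars ℤ).comap φ
  let r := Module.finrank ℤ Λ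
  let b : Basis (Fin r) ℤ Λ := Module.finBasis ℤ Λ
  let lam : Fin r → Fin t → ℂ := fun k j => (((b k : Fin t → ℤ) j : ℤ) : ℂ)
  obtain ⟨hli, hS⟩ := finrank_span_intCast Λ b
  have hlamU : ∀ k, M *ᵥ lam k ∈ U := fun k => by
    have h : φ ((b k : Λ) : Fin t → ℤ) ∈ U.restrictScalars ℤ := Submodule.mem_comap.mp (b k).2
    exact h
  -- `rang_ℤ(X/(X ∩ U)) = t - r`
  have hquot : Module.finrank ℤ (↥X ⧸ (U.restrictScalars ℤ).comap X.subtype) + r = t := by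
    let ψ : (Fin t → ℤ) →ₗ[ℤ] (↥X ⧸ (U.restrictScalars ℤ).comap X.subtype) :=
      ((U.restrictScalars ℤ).comap X.subtype).mkQ.comp φ.rangeRestrict
    have hψ : Function.Surjective ψ :=
      (Submodule.mkQ_surjective _).comp (LinearMap.surjective_rangeRestrict φ)
    have hker : LinearMap.ker ψ = Λ := by
      ext z
      rw [LinearMap.mem_ker]
      change ((U.restrictScalars ℤ).comap X.subtype).mkQ (φ.rangeRestrict z) = 0 ↔ z ∈ Λ
      rw [Submodule.mkQ_apply, Submodule.Quotient.mk_eq_zero, Submodule.mem_comap]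
      rfl
    have e := (Submodule.quotEquivOfEq _ _ hker).symm.trans (ψ.quotKerEquivOfSurjective hψ)
    rw [← e.finrank_eq]
    have := Submodule.finrank_quotient_add_finrank Λ
    rwa [Module.finrank_fin_fun] at this
  -- the evaluation maps `N ↦ N λₖ` on `ℂ^{d × t}`, defined over `ℚ`
  let ev : Fin r → (Fin d × Fin t → ℂ) →ₗ[ℂ] (Fin d → ℂ) := fun k =>
    { toFun := fun F i => ∑ j, F (i, j) * lam k j
      map_add' := fun F G => by funext i; simp [add_mul, Finset.sum_add_distrib]
      map_smul' := fun c F => by funext i; simp [Finset.mul_sum, mul_assoc] }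
  let ev₀ : Fin r → (Fin d × Fin t → ℚ) →ₗ[ℚ] (Fin d → ℚ) := fun k =>
    { toFun := fun F i => ∑ j, F (i, j) * ((b k : Fin t → ℤ) j : ℚ)
      map_add' := fun F G => by funext i; simp [add_mul, Finset.sum_add_distrib]
      map_smul' := fun c F => by funext i; simp [Finset.mul_sum, mul_assoc] }
  have hev : ∀ k (v : Fin d × Fin t → ℚ), ev k (ofK ℚ v) = ofK ℚ (ev₀ k v) := by
    intro k v; funext i; simp [ev, ev₀, lam, ofK]
  -- `U` is `ℚ`-rational, hence so is `T♭ = ⋂ₖ evₖ⁻¹(U)`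
  have hUrat : IsKRational ℚ U := by
    refine ⟨s, ?_⟩
    rw [hUs, ratSpan]
    congr 1
  let Tf : Submodule ℂ (Fin d × Fin t → ℂ) := ⨅ k, U.comap (ev k)
  have hTf : IsKRational ℚ Tf :=
    isKRational_iInf fun k => hUrat.comap_of_ofK (ev k) (ev₀ k) (hev k)
  -- back to matrices
  let e : Matrix (Fin d) (Fin t) ℂ ≃ₗ[ℂ] (Fin d × Fin t → ℂ) :=
    (Matrix.ofLinearEquiv ℂ).symm.trans (LinearEquiv.curry ℂ ℂ (Fin d) (Fin t)).symm
  have he : ∀ (N : Matrix (Fin d) (Fin t) ℂ) (p : Fin d × Fin t), e N p = N p.1 p.2 := fun N p => rfl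
  let T : Submodule ℂ (Matrix (Fin d) (Fin t) ℂ) := Tf.comap e.toLinearMap
  have hTmem : ∀ N, N ∈ T ↔ ∀ k, N *ᵥ lam k ∈ U := by
    intro N
    simp only [T, Tf, Submodule.mem_comap, Submodule.mem_iInf, LinearEquiv.coe_coe]
    refine forall_congr' fun k => ?_
    have : ev k (e N) = N *ᵥ lam k := by
      funext i; simp [ev, he, Matrix.mulVec, dotProduct]
    rw [this]
  have hMT : M ∈ T := (hTmem M).mpr hlamU
  have hTrat : ∃ S : Set (Matrix (Fin d) (Fin t) ℚ),
      T = span ℂ ((fun A : Matrix (Fin d) (Fin t) ℚ => A.map (algebraMap ℚ ℂ)) '' S) := by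
    obtain ⟨s', hs'⟩ := hTf
    refine ⟨(fun v => Matrix.of fun i j => v (i, j)) '' s', ?_⟩
    have hT : T = Tf.map (e.symm : (Fin d × Fin t → ℂ) →ₗ[ℂ] Matrix (Fin d) (Fin t) ℂ) := by
      simp only [T]
      exact (Submodule.map_equiv_eq_comap_symm e.symm Tf).symm ▸ by simp
    rw [hT, hs', Submodule.map_span, ← Set.image_comp, ← Set.image_comp]
    refine congrArg _ (Set.image_congr fun v _ => ?_)
    apply e.injective
    rw [LinearEquiv.coe_coe, Function.comp_apply, Function.comp_apply, LinearEquiv.apply_symm_apply]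
    funext p
    rw [he]
    simp [ofK]
  -- the rank bound on `T`
  have hrank : ∀ N ∈ T, N.rank + r ≤ Module.finrank ℂ U + t := by
    intro N hN
    let Sp : Submodule ℂ (Fin t → ℂ) := span ℂ (Set.range lam)
    obtain ⟨S', hS'⟩ := Sp.exists_isCompl
    have hNS : Sp.map N.mulVecLin ≤ U := by
      rw [Submodule.map_span, span_le]
      rintro _ ⟨_, ⟨k, rfl⟩, rfl⟩
      exact (hTmem N).mp hN k
    have h1 : LinearMap.range N.mulVecLin ≤ U ⊔ S'.map N.mulVecLin := by
      rw [LinearMap.range_eq_map, ← hS'.sup_eq_top, Submodule.map_sup]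
      exact sup_le_sup_right hNS _
    have h2 : N.rank ≤ Module.finrank ℂ U + Module.finrank ℂ S' := by
      calc N.rank = Module.finrank ℂ (LinearMap.range N.mulVecLin) := rfl
        _ ≤ Module.finrank ℂ ↥(U ⊔ S'.map N.mulVecLin) := Submodule.finrank_mono h1
        _ ≤ Module.finrank ℂ U + Module.finrank ℂ ↥(S'.map N.mulVecLin) :=
            Submodule.finrank_add_le_finrank_add_finrank _ _
        _ ≤ Module.finrank ℂ U + Module.finrank ℂ S' :=
            Nat.add_le_add_left (Submodule.finrank_map_le _ _) _
    have h3 : Module.finrank ℂ Sp + Module.finrank ℂ S' = t := by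
      have := Submodule.finrank_sup_add_finrank_inf_eq Sp S'
      rw [hS'.sup_eq_top, hS'.inf_eq_bot, finrank_bot, add_zero, finrank_top,
        Module.finrank_fin_fun] at this
      exact this.symm
    have h4 : Module.finrank ℂ Sp = r := hS
    omega
  refine ⟨⟨T, hTrat, hMT, fun N hN => ?_⟩, fun hcol => ⟨T, hTrat, hMT, fun N hN => ?_⟩⟩
  · have := hrank N hN
    rw [hn] at hle
    omega
  · obtain ⟨j, hjalg, i, hij⟩ := hcol
    have hx : ∃ x ∈ X, x ≠ 0 ∧ ∀ i, IsAlgebraic ℚ (cexp (x i)) := by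
      refine ⟨φ (Pi.single j 1), ⟨_, rfl⟩, ?_, ?_⟩
      · have e1 : φ (Pi.single j 1) = M.col j := by
          rw [hφ]
          have e2 : (fun k => (((Pi.single j (1 : ℤ) : Fin t → ℤ) k : ℤ) : ℂ)) = Pi.single j (1 : ℂ) := by
            funext k; by_cases h : k = j
            · subst h; simp
            · simp [h]
          rw [e2, Matrix.mulVec_single, MulOpposite.op_one, one_smul]
        rw [e1]
        intro h0
        exact hij (by simpa using congrFun h0 i)
      · intro i'
        have e1 : φ (Pi.single j 1) i' = M i' j := by
          rw [hφ]
          have e2 : (fun k => (((Pi.single j (1 : ℤ) : Fin t → ℤ) k : ℤ) : ℂ)) = Pi.single j (1 : ℂ) := by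
            funext k; by_cases h : k = j
            · subst h; simp
            · simp [h]
          rw [e2, Matrix.mulVec_single, MulOpposite.op_one, one_smul, Matrix.col_apply]
        rw [e1]; exact hjalg i'
    have := hrank N hN
    have hlt' := hlt hx
    rw [hn] at hlt'
    omega

end RoyWaldschmidt1997

open RoyWaldschmidt1997 in
/-- **Roy–Waldschmidt 1997: Théorème 0.2 from Corollaire 1.4** (composition of the two printed
deductions Théorème 0.2 ⇐ Théorème 0.1, §7, and Théorème 0.1 ⇐ Corollaire 1.4, p. 760, both
PROVED; Corollaire 1.4 ⇐ Corollaire 1.3 ⇐ Théorème 1.1 remain).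
[cite: RoyWaldschmidt1997ENS, Corollaire 1.4 p. 759, Théorème 0.1–0.2 p. 755] -/
theorem royWaldschmidt_quadratic_thm_0_2_of_cor_1_4
    (h14 : ∀ (K : IntermediateField ℚ ℂ), Algebra.trdeg ℚ K = 1 →
      ∀ (d : ℕ) (X : Submodule ℤ (Fin d → ℂ)), X.FG →
        (∀ x ∈ X, ∀ i, x i ∈ K ∧ cexp (x i) ∈ K) →
        ∃ U : Submodule ℂ (Fin d → ℂ), (∃ s : Set (Fin d → ℚ), U = ratSpan s) ∧
          Module.finrank ℤ (↥X ⧸ (U.restrictScalars ℤ).comap X.subtype) + Module.finrank ℂ U ≤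
            2 * Module.finrank ℂ (span ℂ (X : Set (Fin d → ℂ))) ∧
          ((∃ x ∈ X, x ≠ 0 ∧ ∀ i, IsAlgebraic ℚ (cexp (x i))) →
            Module.finrank ℤ (↥X ⧸ (U.restrictScalars ℤ).comap X.subtype) + Module.finrank ℂ U <
              2 * Module.finrank ℂ (span ℂ (X : Set (Fin d → ℂ))))) :
    royWaldschmidt_quadratic_thm_0_2 :=
  royWaldschmidt_quadratic_thm_0_2_of_thm_0_1 fun K hK d t M hM => thm_0_1_of_cor_1_4 h14 K hK d t M hM

end Literature.NumberTheory.Transcendental
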